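import Literature.NumberTheory.EllipticCurves.Rank1Residual.X10MainConjecture
import HarnessLib

/-!
# X10 at rank `0`, EITHER mod-`3` image: an INTEGRAL cyclotomic main conjecture at `(E, 3)` suffices for `BSD(E, 3)`

HONEST FRAMING (cell `b2b-bsdres`, run/shared/lean/b2b/bsd-rank1-residual/, verbatim): the goal of
the cell is to DELETE the COMBINATION-SHAPED residual classes for ALL analytic-rank `≤ 1` elliptic
curves over `ℚ` — "full BSD formula for every rank `≤ 1` curve in class C" assembled STRICTLY from
published theorems — so that the rank-`≤ 1` remainder becomes exactly the CONSTRUCTION-SHAPED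
classes, which are TYPED (missing-input `Prop`s), NOT attempted. This is not "finishing BSD".

Theorems only (no definition, no new named fact; D-0014). Unit `b2b-bsdres-x10` (X10 prover), gen 5;
companion of `Rank1Residual/X10MainConjecture.lean` (same day). That file identified, on
X10a′ ∧ r = 0 (surj(3)), the missing lower bound with Mazur's main conjecture (an iff, through Kato's
integral divisibility). On X10b = X10 ∧ ¬surj(3) (image a Cartan normaliser, order prime to `3`) Kato's
INTEGRAL clause is unavailable (no rank-one-cokernel element: `ClassX10.not_bigIm_of_not_surj`), so no
iff is claimed there; what IS available at rank `0` for EITHER image is SUFFICIENCY: an integral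
cyclotomic main conjecture at `(E, 3)` (`char_Λ X = (g)`, `ι g = L_p(f, α)` — the `f`-normalised
equality, the body of the X9 seat's typed input `IntegralMainConjectureOnClassX9` read at `p = 3`;
on X10a′ it is Yan–Zhu 2026 Thm. 4.9 [PUB\*, flag `YZ26@3-BF-ERL-Ohta`], on X10b it is the typed
missing object, announced "[BS24]", not out) implies Miller's `BSD(E, 3)`, by the X9 seat's argument
(`Summits/…/Rank1ResidualX9RankZero.lean`, whose class predicate `ClassX9` requires `5 ≤ p` and so
does not literally cover X10b = "X9 at `p = 3`"): the period ratio `ϖ` is a `3`-adic unit at an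
irreducible good `3` (inline `hϖ`), so `ϖ · g` generates `char_Λ X` in the Néron normalisation, and
`padicValRat_bsd_rank_zero_of_mazurMainConjecture` (Castella–Grossi–Lee–Skinner 2022, proof of
Thm. 5.1.4: interpolation + Greenberg Thm. 4.1) + `bsdp_of_padicValRat_rank_zero` give `BSDp W 3`.
So X10b ∧ r = 0 is EXACTLY one integral main conjecture away from closed (sufficiency), matching the
referee's reading of X9 ∧ r = 0 (R9.4).

* `X10.bsdp_three_rankZero_of_integralMainConjecture` — `ClassX10 W 3 → r_an = 0 → (integral MC at
  (E,3), f-normalisation, every datum) → BSDp W 3` (facts: Greenberg 4.1, modularity, GZK; inline `hϖ`).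
* `X10.missingInputAt_rankZero_of_integralMainConjecture` — hence `Typed.X10.MissingInputAt W`.

References: [CastellaEtAl2021] Thm. 5.1.4 (proof); [GreenbergLNM1716] Thm. 4.1; [SkinnerUrban2014]
§3.6.7 (p. 45); [Miller2011LMS] Def. 1.1; cell files X10-AUDIT.md §11, Typed/X10.lean,
Summits/…/Rank1ResidualX9RankZero.lean.
-/

set_option autoImplicit false

noncomputable section

open scoped Classical MatrixGroups ModularForm

open CongruenceSubgroup WeierstrassCurve Literature.NumberTheory.EllipticCurves
  Literature.NumberTheory.EllipticCurves.ModularForms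
  Literature.NumberTheory.EllipticCurves.Wuthrich2014

namespace Literature.NumberTheory.EllipticCurves.Rank1Residual

section X10AnyImage

variable (W : WeierstrassCurve ℚ) [W.IsElliptic] [W.IsGloballyMinimal]

/-- **X10 ∧ r = 0 (surj(3) or not): an integral cyclotomic main conjecture at `(E, 3)` ⟹ `BSD(E, 3)`.**
Hypothesis `hIMC`: for the cyclotomic `κ, γ`, every newform `f` of `E` of level `N_E` and every dual
datum `D`, `X` is `Λ`-torsion and `char_Λ X = (g)` with `ι g = L_p(f, α)` — the `f`-normalised INTEGRAL
equality, i.e. the body of the X9 seat's typed input `IntegralMainConjectureOnClassX9` read at `p = 3`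
(on X10a′ this is Yan–Zhu 2026 Thm. 4.9 [PUB\*, flag `YZ26@3-BF-ERL-Ohta`]; on X10b it is the typed
missing object, announced "[BS24]", not out). PUBLISHED inputs: Greenberg LNM 1716 Thm. 4.1 (`hGr`),
modularity with an integral Manin constant (`hmod`), Gross–Zagier–Kolyvagin (`hGZK`); the period unit
`hϖ` (inline, irreducible good `3`). Conclusion `BSDp W 3`. Proof = the X9 seat's
`bsdp_of_integralMainConjectureOnClassX9_of_analyticRank_eq_zero`: `ϖ ∈ ℤ_3^×`, so `ϖ · g` generates
`char_Λ X` with `ι(ϖ g) = ϖ · L_p(f, α)` (Néron normalisation), and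
`padicValRat_bsd_rank_zero_of_mazurMainConjecture` (Castella–Grossi–Lee–Skinner 2022, proof of
Thm. 5.1.4) + `bsdp_of_padicValRat_rank_zero` give Miller's `BSD(E,3)`. So X10b ∧ r = 0 is EXACTLY one
integral main conjecture away from closed (sufficiency; the converse direction needs an integral
DIVISIBILITY, which Kato's theorem does not print for the X10b images — §11 of X10-AUDIT.md).
[cite: CastellaEtAl2021, Thm. 5.1.4 and its proof (§5.1.3)] [cite: GreenbergLNM1716, Thm. 4.1 (p. 102)]
[cite: SkinnerUrban2014, §3.6.7 (p. 45)] [cite: Miller2011LMS, Def. 1.1 (arXiv:1010.2431 p. 3)] -/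
theorem X10.bsdp_three_rankZero_of_integralMainConjecture (hGr : greenberg_charValue_rankZero)
    (hmod : nonempty_modularParametrizationData)
    (hGZK : rank_eq_analyticRank_of_analyticRank_le_one)
    (hϖ : ∀ [NeZero (W.conductorNorm ℤ)] (f : CuspForm (Gamma0 (W.conductorNorm ℤ)) 2),
      IsNewformOf W f → ∀ ϖ : ℚ, (ϖ : ℝ) * W.realPeriodRat = plusPeriod f → padicValRat 3 ϖ = 0)
    (hX : ClassX10 W 3) (hr0 : W.analyticRank = 0)
    (hIMC : ∀ (κ : ZpExtension ℚ 3) (γ : Field.absoluteGaloisGroup ℚ),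
        κ.IsCyclotomic → κ.IsTopGenerator γ → IsCyclotomicVariable 3 γ →
      ∀ [NeZero (W.conductorNorm ℤ)] (f : CuspForm (Gamma0 (W.conductorNorm ℤ)) 2),
        IsNewformOf W f →
      ∀ (D : W.SelmerDualData κ γ), D.IsTorsion ∧
        ∃ g : IwasawaAlgebra 3, D.charIdeal = Ideal.span {g} ∧
          iwasawaToPowerSeries 3 g = padicLFunction f (unitRoot W 3 : ℚ_[3])) :
    BSDp W 3 := by
  haveI : NeZero (W.conductorNorm ℤ) := ⟨(W.conductorNorm_pos_holds).ne'⟩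
  obtain ⟨Dm⟩ := hmod W
  have hL : W.entireLFunction 1 ≠ 0 :=
    (W.analyticRank_eq_zero_iff_holds Dm.isNewformOf.hasEntireLFunction).mp hr0
  have hfin : Finite W.sha := (hGZK W (by rw [hr0]; exact zero_le_one)).2
  refine bsdp_of_padicValRat_rank_zero W 3 hr0 hL hGZK
    (padicValRat_bsd_rank_zero_of_mazurMainConjecture W 3 hX.2.1.1 hX.2.1.2 hL hfin hmod
      (hGr W 3 (by decide) hX.2.1.1 hX.2.1.2) ?_)
  -- Mazur's main conjecture in the Néron normalisation, from `hIMC` and the unit `ϖ`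
  intro κ γ hκ hγ hγ' _ f hf ϖ hϖeq D
  obtain ⟨htors, g, hchar, hιg⟩ := hIMC κ γ hκ hγ hγ' f hf D
  have hϖ0 : ϖ ≠ 0 := varpi_ne_zero_of_entireLFunction_one_ne_zero W hL hf hϖeq
  have hval : padicValRat 3 ϖ = 0 := hϖ f hf ϖ hϖeq
  have hnorm : ‖(ϖ : ℚ_[3])‖ = 1 := by
    rw [Padic.eq_padicNorm, padicNorm.eq_zpow_of_nonzero hϖ0, hval, neg_zero, zpow_zero,
      Rat.cast_one]
  set c : ℤ_[3] := ⟨(ϖ : ℚ_[3]), hnorm.le⟩ with hc_def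
  have hcu : IsUnit c := PadicInt.isUnit_iff.mpr hnorm
  refine ⟨htors, PowerSeries.C c * g, ?_, ?_⟩
  · rw [hchar]
    exact (Ideal.span_singleton_mul_left_unit (hcu.map PowerSeries.C) g).symm
  · rw [map_mul, hιg, PowerSeries.map_C]
    rfl

/-- **Hence on X10b ∧ r = 0 the typed missing input `X10.MissingInputAt W` (`Typed/X10.lean`:
`¬Surj W 3 → MissingPPartAt W 3`) is DISCHARGED by an integral main conjecture at `(E, 3)`** (same
facts): the Literature-side typing (the OUTPUT in Miller's currency) and the object-level typing (an
integral IMC for a small irreducible image at `3`) agree in rank `0`, as for X9 (R9.4). Bookkeeping.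
[cite: CastellaEtAl2021, Thm. 5.1.4 and its proof (§5.1.3)] [cite: Miller2011LMS, Def. 1.1] -/
theorem X10.missingInputAt_rankZero_of_integralMainConjecture (hGr : greenberg_charValue_rankZero)
    (hmod : nonempty_modularParametrizationData)
    (hGZK : rank_eq_analyticRank_of_analyticRank_le_one)
    (hϖ : ∀ [NeZero (W.conductorNorm ℤ)] (f : CuspForm (Gamma0 (W.conductorNorm ℤ)) 2),
      IsNewformOf W f → ∀ ϖ : ℚ, (ϖ : ℝ) * W.realPeriodRat = plusPeriod f → padicValRat 3 ϖ = 0)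
    (hX : ClassX10 W 3) (hr0 : W.analyticRank = 0)
    (hIMC : ∀ (κ : ZpExtension ℚ 3) (γ : Field.absoluteGaloisGroup ℚ),
        κ.IsCyclotomic → κ.IsTopGenerator γ → IsCyclotomicVariable 3 γ →
      ∀ [NeZero (W.conductorNorm ℤ)] (f : CuspForm (Gamma0 (W.conductorNorm ℤ)) 2),
        IsNewformOf W f →
      ∀ (D : W.SelmerDualData κ γ), D.IsTorsion ∧
        ∃ g : IwasawaAlgebra 3, D.charIdeal = Ideal.span {g} ∧
          iwasawaToPowerSeries 3 g = padicLFunction f (unitRoot W 3 : ℚ_[3])) :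
    Typed.X10.MissingInputAt W := by
  haveI : Finite W.sha := (hGZK W hX.analyticRank_le_one).2
  exact Typed.X10.missingInputAt_of_bsdp W
    (X10.bsdp_three_rankZero_of_integralMainConjecture W hGr hmod hGZK hϖ hX hr0 hIMC)

end X10AnyImage

end Literature.NumberTheory.EllipticCurves.Rank1Residual

end
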